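/-
Copyright (c) 2026 the pub-hodgecm-mathlib formalisation cell (harness21).  Prover seat hodgecm-mathlib-LH4-p06 (g5), Track A «(D-RAM) FOUR-FRAME», unit U2H, census leaf
(ρ2b′-X) `stub_U2H_fixedPointCensus_typeTwo_unit0` — T5c «TORIC LEVEL CENSUS, M∕E-RAMIFIED»: (D3-LAW) the CLOSED FORM of the top bit — PREPARATORY LEMMAS: the
`τ = Θρ` norm `N_τ` on the `ρ`-norm-one torus, and the three quadratic layers `M ∕ E`, `M ∕ K_τ`, `K_τ ∕ F` read in ONE-FIELD currency on `M`.  2026-09-04.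
-/
import Summits.HodgeConjecture.HodgeConjecture.Theorems.F0P3cDyRamToricLevelCensusRamMTopBit        -- ★ p857700∕p857736 (this seat): the bit in order currency; brings ★ RamM heads, ★ p857465 (`exists_fixed_mul_of_unit_depth`)
import Summits.HodgeConjecture.HodgeConjecture.Theorems.F0P3cDyRamToricLevelCensusUnrTopSidePrep   -- ★ (LH4-p08 (g5)): `exists_rep_of_mul_map_eq_one` (Hilbert 90 coset representatives on a datum field)
import Literature.NumberTheory.LocalFields.WildQuadraticDatumNormSurjective                       -- ★ (LH4-p02 (g12)): Serre V §3 Cor. 3, `exists_mul_map_eq_of_isRamifiedQuadraticDatum`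
import Literature.NumberTheory.LocalFields.WildQuadraticDatumTraceBound                            -- ★ `trace_bound_pow_of_isRamifiedQuadraticDatum` (`|a + σa| ≤ |ϖ|^{d−1}|a|`)
import Literature.NumberTheory.LocalFields.WildQuadraticDatumNormOneQuotient                       -- ★ `v_div_map_sub_one_eq_of_v_eq_v_varpi` (`ϖ`-quotients have depth exactly `d − 1`)
import HarnessLib

/-!
# T5c (D3-LAW) prep: the norm `N_τ`, `τ = Θρ`, on the `ρ`-norm-one torus of `M`, and the layers `M ∕ E`, `M ∕ K_τ`, `K_τ ∕ F` in one-field currency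

Cell `hodgecm-mathlib` (D-0151), FLOOR 0, crux H413 = `stmt-HodgeConjecture-24833`; squad F0∕P3c∕LH4; lane `--supports stmt-HodgeConjecture-24833 --as helper` (count-neutral).
THEOREMS ONLY (no `def`, no instance, no notation, no `sorry`, default heartbeats).  Socket served: the closed form of the (D3) top bit `χ` of ★ p857665 (LH4-p04 (g4)'s DERIVED
T5s-RamM letter `2j + d_E ≤ 2jλ + 1 ∧ …`, ★ p857711 `hvTop`), sequel `…RamMTopLaw`.

THE MECHANISM (RamM twin of LH4-p08 (g5)'s ★ (R1-TOP-SIDE) «`κ` dies in `T_M ∕ T♮` at a computable depth», with the `Θ`-averaging replaced by the norm to the FOURTH FIELD).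
Frame on the one field `M` (`K` below): commuting isometric involutions `ρ` (fixing `E`), `Θ` (fixing `K♮`), and `τ` with `τ = Θ∘ρ` (fixing `K_τ`); `T := {x : xρx = 1}`,
`T♮ := T ∩ K♮`; `ψ(y) := ρy∕y`; `N_τ(x) := x·τx`.
* §1 `τ`-ALGEBRA: `ττ = 1`, `τρ = ρτ = Θ`; **`mul_tau_eq_one_of_thetaFixed`** ∕ **`thetaFixed_of_mul_tau_eq_one`** — on `T`, `N_τ(x) = 1 ⟺ Θx = x` (`τx = Θ(x⁻¹)`), so
  `T ∕ T♮ ↪ K_τ` by `N_τ`; **`norm_tau_twist`** — `N_τ(ψ(y)) = ψ(N_τ(y))`; **`norm_tau_kappa`** — for `μ = λ − u` with `λΘλ = 1`, `ρu = u`, `uΘu = 1`: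
  `N_τ(ρμ∕μ) = ρλ∕λ` (u-FREE: the token `|μ − ρμ| = |λ − ρλ|` is exactly the depth of `N_τ(κ)`).
* §2 THE LAYER `K_τ ∕ F` IN ONE-FIELD CURRENCY (`P` a `τ`-fixed element with `|P| = exp(−2)`, `|P − ρP| = exp(−2d_K)`; `F`-elements = `ρ`- and `τ`-fixed, valuations in `4ℤ`):
  Eisenstein coordinates `z = a + bP` (`exists_coords_tauFixed`), `|a + bP| = max(|a|, |b||P|)` (`v_coords_eq_max`), the DIFFERENT BOUND **`v_sub_map_le_of_tauFixed`**
  (`|z − ρz| ≤ |z|·exp(−(2d_K − 2))`) and HILBERT 90 WITH DEPTH **`exists_tauFixed_twist_eq_of_depth`** (a `K_τ`-norm-one `w` with `|w − 1| ≤ exp(−e)`, `e > 2d_K − 2`, is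
  `ρz∕z` for a `τ`-fixed one-unit `z` with `|z − 1| ≤ exp(−(e − 2d_K + 2))`).
* §3 THE LAYER `M ∕ K_τ`: **`v_mul_tau_sub_one_le`** — `|y − 1| ≤ exp(−i)`, `dτ ≤ i + 1` ⇒ `|N_τ(y) − 1| ≤ exp(−(i + dτ − 1))` (★ trace bound on the datum `(τ, α, dτ)`); the
  converse is ★ Serre V §3 Cor. 3 `exists_mul_map_eq_of_isRamifiedQuadraticDatum`.
* §4 THE LAYER `M ∕ E`: **`v_twist_sub_one_le_of_oneUnit`** (`|y − 1| ≤ exp(−(2c+1)) ⇒ |ψ(y) − 1| ≤ exp(−(2c + d_ρ))`, coordinates on `(ρ, α, d_ρ)`) and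
  **`exists_oneUnit_twist_eq`** (`tρt = 1`, `|t − 1| ≤ exp(−(2c + d_ρ))` ⇒ `t = ψ(y)` with `|y − 1| ≤ exp(−(2c + 1))`: ★ Hilbert 90 representatives, the `α`-coset excluded by
  its exact depth `d_ρ − 1` ★, the unit coset factored by ★ `exists_fixed_mul_of_unit_depth`).
HONEST LABEL.  Count-neutral (`--supports`); unconditional local algebra; nothing of (ρ2b′-X) is asserted — `HC_CM` is proved only modulo the 7 printed citations (2 remaining
named inputs: hLiu418 = `stmt-HodgeConjecture-24832`, h413 = `stmt-HodgeConjecture-24833`) until rung 0 closes.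

## References
* [Serre1979] J.-P. Serre, *Local Fields*, GTM 67 (1979): Ch. III §3 Prop. 7 (trace ideals), Ch. IV §1 Prop. 3–4, Ch. V §3 Prop. 5 and Cor. 3 (norm groups), Ch. X §1 (Hilbert 90).
* [Jacobowitz1962] R. Jacobowitz, *Hermitian forms over local fields*, Amer. J. Math. 84 (1962): §4.
* [Flicker1998UnitaryFL] Y. Z. Flicker, *Elementary proof of the fundamental lemma for a unitary group*, Canad. J. Math. 50 (1998): p. 84.
-/

set_option autoImplicit false

noncomputable section

namespace Summit.HodgeConjecture.HodgeConjecture.Cruxes.H413.F0P3cDyRamToricLevelCensusRamM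

open WithZero
open scoped Valued
open Literature.NumberTheory.Automorphic.UnitaryThreeFourFrame (IsRamifiedQuadraticDatum)
open Literature.NumberTheory.LocalFields.QuadraticOrder Literature.NumberTheory.LocalFields.WildQuadraticDatum
open Summit.HodgeConjecture.HodgeConjecture.Cruxes.H413.F0P3cDyRamToricLevelCensusUnr (exists_rep_of_mul_map_eq_one)

variable {K : Type} [Field K] [Valued K ℤᵐ⁰] {ρ Θ τ : K →+* K} {α : K} {dρ t dτ tτ : ℕ}

/-! ## §1 `τ`-algebra on the torus -/

omit [Valued K ℤᵐ⁰] in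
/-- `τ = Θρ` is an involution (`ρ`, `Θ` commuting involutions). [cite: Serre1979, Ch. IV §1] -/
theorem tau_tau (hτ : ∀ x, τ x = Θ (ρ x)) (hρρ : ∀ x, ρ (ρ x) = x) (hΘΘ : ∀ x, Θ (Θ x) = x) (hΘρ : ∀ x, Θ (ρ x) = ρ (Θ x)) (x : K) :
    τ (τ x) = x := by
  rw [hτ, hτ, ← hΘρ, hρρ, hΘΘ]

omit [Valued K ℤᵐ⁰] in
/-- `τρ = Θ`. [cite: Serre1979, Ch. IV §1] -/
theorem tau_rho (hτ : ∀ x, τ x = Θ (ρ x)) (hρρ : ∀ x, ρ (ρ x) = x) (x : K) : τ (ρ x) = Θ x := by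
  rw [hτ, hρρ]

omit [Valued K ℤᵐ⁰] in
/-- `ρτ = Θ`. [cite: Serre1979, Ch. IV §1] -/
theorem rho_tau (hτ : ∀ x, τ x = Θ (ρ x)) (hρρ : ∀ x, ρ (ρ x) = x) (hΘρ : ∀ x, Θ (ρ x) = ρ (Θ x)) (x : K) : ρ (τ x) = Θ x := by
  rw [hτ, ← hΘρ, hρρ]

omit [Valued K ℤᵐ⁰] in
/-- **`N_τ` KILLS `T♮`**: a `Θ`-fixed `ρ`-norm-one `x` has `x·τx = 1` (`τx = Θ(ρx) = Θ(x⁻¹) = x⁻¹`). [cite: Serre1979, Ch. V §3] -/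
theorem mul_tau_eq_one_of_thetaFixed (hτ : ∀ x, τ x = Θ (ρ x)) {x : K} (hΘx : Θ x = x) (hx : x * ρ x = 1) : x * τ x = 1 := by
  have hx0 : x ≠ 0 := fun h0 => by rw [h0, zero_mul] at hx; exact zero_ne_one hx
  have hρx : ρ x = x⁻¹ := eq_inv_of_mul_eq_one_right hx
  rw [hτ, hρx, map_inv₀, hΘx, mul_inv_cancel₀ hx0]

omit [Valued K ℤᵐ⁰] in
/-- **… AND ONLY `T♮`**: a `ρ`-norm-one `x` with `x·τx = 1` is `Θ`-fixed (`ρx = x⁻¹ = τx`, so `Θx = τ(ρx) = τ(τx) = x`) — `N_τ` embeds `T ∕ T♮` into the fourth field.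
[cite: Serre1979, Ch. V §3] -/
theorem thetaFixed_of_mul_tau_eq_one (hτ : ∀ x, τ x = Θ (ρ x)) (hρρ : ∀ x, ρ (ρ x) = x) (hΘΘ : ∀ x, Θ (Θ x) = x) (hΘρ : ∀ x, Θ (ρ x) = ρ (Θ x))
    {x : K} (hx : x * ρ x = 1) (hxτ : x * τ x = 1) : Θ x = x := by
  have hρx : ρ x = τ x := by rw [eq_inv_of_mul_eq_one_right hx, eq_inv_of_mul_eq_one_right hxτ]
  rw [← tau_rho hτ hρρ x, hρx, tau_tau hτ hρρ hΘΘ hΘρ]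

omit [Valued K ℤᵐ⁰] in
/-- **`N_τ ∘ ψ = ψ ∘ N_τ`**: `(ρy∕y)·τ(ρy∕y) = ρ(yτy)∕(yτy)` (`τρ = ρτ = Θ`). [cite: Serre1979, Ch. V §3] -/
theorem norm_tau_twist (hτ : ∀ x, τ x = Θ (ρ x)) (hρρ : ∀ x, ρ (ρ x) = x) (hΘρ : ∀ x, Θ (ρ x) = ρ (Θ x)) (y : K) :
    ρ y / y * τ (ρ y / y) = ρ (y * τ y) / (y * τ y) := by
  rw [map_div₀, tau_rho hτ hρρ, map_mul, rho_tau hτ hρρ hΘρ, div_mul_div_comm]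

omit [Valued K ℤᵐ⁰] in
/-- **THE KEY IDENTITY `N_τ(ρμ∕μ) = ρλ∕λ`** for `μ = λ − u`, `λΘλ = 1`, `ρu = u`, `uΘu = 1` (`μ ≠ 0`, `ρμ ≠ 0`): `τμ = (ρλ)⁻¹ − u⁻¹ = −ρμ∕(uρλ)`, `Θμ`-free bookkeeping — the
u-FREE quantity whose depth `|λ − ρλ| = |μ − ρμ|` is the census token `jλ`. (LH4-p08 (g5)'s type-U `Φ(μ∕ρμ) = λ∕ρλ`.) [cite: Jacobowitz1962, §4] [cite: Serre1979, Ch. V §3] -/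
theorem norm_tau_kappa (hτ : ∀ x, τ x = Θ (ρ x)) (hρρ : ∀ x, ρ (ρ x) = x) (hΘρ : ∀ x, Θ (ρ x) = ρ (Θ x))
    {lam u : K} (hlam : lam * Θ lam = 1) (hu : ρ u = u) (hu1 : u * Θ u = 1) (hμ0 : lam - u ≠ 0) (hρμ0 : ρ lam - u ≠ 0) :
    ρ (lam - u) / (lam - u) * τ (ρ (lam - u) / (lam - u)) = ρ lam / lam := by
  have hlam0 : lam ≠ 0 := fun h0 => by rw [h0, zero_mul] at hlam; exact zero_ne_one hlam
  have hu0 : u ≠ 0 := fun h0 => by rw [h0, zero_mul] at hu1; exact zero_ne_one hu1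
  have hρlam0 : ρ lam ≠ 0 := (map_ne_zero ρ).2 hlam0
  have hΘu : Θ u = u⁻¹ := (inv_eq_of_mul_eq_one_right hu1).symm
  have hΘρlam : Θ (ρ lam) = (ρ lam)⁻¹ := by
    have h1 : ρ lam * Θ (ρ lam) = 1 := by rw [hΘρ, ← map_mul, hlam, map_one]
    exact (inv_eq_of_mul_eq_one_right h1).symm
  have hτμ : τ (lam - u) = (ρ lam)⁻¹ - u⁻¹ := by rw [hτ, map_sub, hu, map_sub, hΘρlam, hΘu]
  have hul : u - lam ≠ 0 := fun h0 => hμ0 (by linear_combination (-1 : K) * h0)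
  have hρul : u - ρ lam ≠ 0 := fun h0 => hρμ0 (by linear_combination (-1 : K) * h0)
  rw [norm_tau_twist hτ hρρ hΘρ, hτμ]
  simp only [map_mul, map_sub, map_inv₀, hρρ, hu]
  field_simp
  ring

/-! ## §2 The layer `K_τ ∕ F` in one-field currency -/

omit [Valued K ℤᵐ⁰] in
/-- **EISENSTEIN COORDINATES ON THE FOURTH FIELD**: a `τ`-fixed `z` is `a + bP` with `a, b` fixed by `ρ` AND `τ` (`P` `τ`-fixed, `ρP ≠ P`; `b = (z − ρz)∕(P − ρP)`).
[cite: Serre1979, Ch. I §6 Prop. 18] -/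
theorem exists_coords_tauFixed (hτ : ∀ x, τ x = Θ (ρ x)) (hρρ : ∀ x, ρ (ρ x) = x) (hΘρ : ∀ x, Θ (ρ x) = ρ (Θ x))
    {P : K} (hτP : τ P = P) (hρP : ρ P ≠ P) {z : K} (hτz : τ z = z) :
    ∃ a b : K, (ρ a = a ∧ τ a = a) ∧ (ρ b = b ∧ τ b = b) ∧ z = a + b * P := by
  have hd : P - ρ P ≠ 0 := sub_ne_zero.2 (Ne.symm hρP)
  have hτρz : τ (ρ z) = ρ z := by rw [tau_rho hτ hρρ, ← rho_tau hτ hρρ hΘρ, hτz]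
  have hτρP : τ (ρ P) = ρ P := by rw [tau_rho hτ hρρ, ← rho_tau hτ hρρ hΘρ, hτP]
  set b : K := (z - ρ z) / (P - ρ P) with hb
  clear_value b
  have hρb : ρ b = b := by
    rw [hb, map_div₀, map_sub, map_sub, hρρ, hρρ, ← neg_sub z, ← neg_sub P, neg_div_neg_eq]
  have hτb : τ b = b := by rw [hb, map_div₀, map_sub, map_sub, hτz, hτρz, hτP, hτρP]
  have hbP : z - ρ z = b * (P - ρ P) := by rw [hb, div_mul_cancel₀ _ hd]
  refine ⟨z - b * P, b, ⟨?_, ?_⟩, ⟨hρb, hτb⟩, by ring⟩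
  · rw [map_sub, map_mul, hρb]; linear_combination (-1 : K) * hbP
  · rw [map_sub, map_mul, hτb, hτP, hτz]

/-- **PARITY ON THE FOURTH FIELD**: for `F`-elements `a, b` (valuations in `4ℤ`) and `|P| = exp(−2)`, `|a + bP| = max(|a|, |b|·|P|)`. [cite: Serre1979, Ch. I §6 Prop. 18] -/
theorem v_coords_eq_max (hF4 : ∀ f : K, ρ f = f → τ f = f → f ≠ 0 → ∃ n : ℤ, Valued.v f = exp (4 * n))
    {P : K} (hP : Valued.v P = exp (-2 : ℤ)) {a b : K} (ha : ρ a = a ∧ τ a = a) (hb : ρ b = b ∧ τ b = b) :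
    Valued.v (a + b * P) = max (Valued.v a) (Valued.v b * exp (-2 : ℤ)) := by
  rcases eq_or_ne b 0 with rfl | hb0
  · simp
  rcases eq_or_ne a 0 with rfl | ha0
  · rw [zero_add, map_mul, hP, map_zero, max_eq_right zero_le]
  have hne : Valued.v a ≠ Valued.v (b * P) := by
    obtain ⟨n, hn⟩ := hF4 a ha.1 ha.2 ha0
    obtain ⟨n', hn'⟩ := hF4 b hb.1 hb.2 hb0
    rw [map_mul, hP, hn, hn', ← exp_add, Ne, exp_inj]; omega
  rw [Valuation.map_add_of_distinct_val _ hne, map_mul, hP]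

/-- **THE DIFFERENT BOUND OF `K_τ ∕ F`** in one-field currency: for `τ`-fixed `z`, `|z − ρz| ≤ |z|·exp(−(2d_K − 2))` (`z − ρz = b(P − ρP)`, `|bP| ≤ |z|`).
[cite: Serre1979, Ch. IV §1 Prop. 3–4] -/
theorem v_sub_map_le_of_tauFixed (hτ : ∀ x, τ x = Θ (ρ x)) (hρρ : ∀ x, ρ (ρ x) = x) (hΘρ : ∀ x, Θ (ρ x) = ρ (Θ x))
    (hF4 : ∀ f : K, ρ f = f → τ f = f → f ≠ 0 → ∃ n : ℤ, Valued.v f = exp (4 * n))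
    {P : K} (hτP : τ P = P) (hP : Valued.v P = exp (-2 : ℤ)) {dK : ℕ} (hdK : Valued.v (P - ρ P) = exp (-(2 * (dK : ℤ))))
    {z : K} (hτz : τ z = z) : Valued.v (z - ρ z) ≤ Valued.v z * exp (-(2 * (dK : ℤ) - 2)) := by
  have hρP : ρ P ≠ P := fun h => by rw [h, sub_self, map_zero] at hdK; exact exp_ne_zero hdK.symm
  obtain ⟨a, b, ha, hb, rfl⟩ := exists_coords_tauFixed hτ hρρ hΘρ hτP hρP hτz
  have hsub : a + b * P - ρ (a + b * P) = b * (P - ρ P) := by rw [map_add, map_mul, ha.1, hb.1]; ring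
  have hbP : Valued.v b * exp (-2 : ℤ) ≤ Valued.v (a + b * P) := by rw [v_coords_eq_max hF4 hP ha hb]; exact le_max_right _ _
  rw [hsub, map_mul, hdK]
  calc Valued.v b * exp (-(2 * (dK : ℤ))) = Valued.v b * exp (-2 : ℤ) * exp (-(2 * (dK : ℤ) - 2)) := by
        rw [mul_assoc, ← exp_add]; congr 2; ring
    _ ≤ Valued.v (a + b * P) * exp (-(2 * (dK : ℤ) - 2)) := mul_le_mul_left hbP _

/-- **HILBERT 90 WITH DEPTH ON THE FOURTH FIELD.**  A `τ`-fixed `w` with `wρw = 1` and `|w − 1| ≤ exp(−e)`, `e > 2d_K − 2`, is `ρz∕z` for a `τ`-fixed UNIT `z` with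
`|z − 1| ≤ exp(−(e − 2d_K + 2))` (Hilbert 90 `w = ρa₀∕a₀` with `a₀ = 1 + ρw` or `P − ρP`; rescale by the `F`-element `(PρP)^k` to `|a| ∈ {1, |P|}`; `|a| = |P|` would force
`|w − 1| = exp(−(2d_K − 2))`; at `|a| = 1` the coordinates `a = a′ + b′P` give `z = a∕a′ = 1 + (b′∕a′)P`). [cite: Serre1979, Ch. X §1] [cite: Serre1979, Ch. V §3] -/
theorem exists_tauFixed_twist_eq_of_depth (hτ : ∀ x, τ x = Θ (ρ x)) (hρρ : ∀ x, ρ (ρ x) = x) (hΘρ : ∀ x, Θ (ρ x) = ρ (Θ x))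
    (hvρ : ∀ x, Valued.v (ρ x) = Valued.v x) (hfixτ : ∀ x : K, τ x = x → x ≠ 0 → ∃ n : ℤ, Valued.v x = exp (2 * n))
    (hF4 : ∀ f : K, ρ f = f → τ f = f → f ≠ 0 → ∃ n : ℤ, Valued.v f = exp (4 * n))
    {P : K} (hτP : τ P = P) (hP : Valued.v P = exp (-2 : ℤ)) {dK : ℕ} (hdK : Valued.v (P - ρ P) = exp (-(2 * (dK : ℤ))))
    {w : K} (hτw : τ w = w) (hw : w * ρ w = 1) {e : ℤ} (hwe : Valued.v (w - 1) ≤ exp (-e)) (he : 2 * (dK : ℤ) - 2 < e) :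
    ∃ z : K, τ z = z ∧ Valued.v z = 1 ∧ ρ z / z = w ∧ Valued.v (z - 1) ≤ exp (-(e - 2 * dK + 2)) := by
  have hρP : ρ P ≠ P := fun h => by rw [h, sub_self, map_zero] at hdK; exact exp_ne_zero hdK.symm
  have hP0 : P ≠ 0 := fun h0 => by rw [h0, map_zero] at hP; exact exp_ne_zero hP.symm
  have hw0 : w ≠ 0 := fun h0 => by rw [h0, zero_mul] at hw; exact zero_ne_one hw
  have hτρw : τ (ρ w) = ρ w := by rw [tau_rho hτ hρρ, ← rho_tau hτ hρρ hΘρ, hτw]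
  have hτρP : τ (ρ P) = ρ P := by rw [tau_rho hτ hρρ, ← rho_tau hτ hρρ hΘρ, hτP]
  -- (1) Hilbert 90: `w = ρa₀ ∕ a₀` with `a₀` `τ`-fixed and non-zero
  obtain ⟨a₀, ha₀0, hτa₀, hwa₀⟩ : ∃ a₀ : K, a₀ ≠ 0 ∧ τ a₀ = a₀ ∧ ρ a₀ = w * a₀ := by
    by_cases h1 : 1 + ρ w = 0
    · have hρw : ρ w = -1 := by linear_combination h1
      have hw1 : w = -1 := by rw [← hρρ w, hρw, map_neg, map_one]
      refine ⟨P - ρ P, sub_ne_zero.2 (Ne.symm hρP), by rw [map_sub, hτP, hτρP], ?_⟩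
      rw [map_sub, hρρ, hw1]; ring
    · refine ⟨1 + ρ w, h1, by rw [map_add, map_one, hτρw], ?_⟩
      rw [map_add, map_one, hρρ, mul_add, mul_one, hw, add_comm]
  -- (2) rescale by the `F`-element `c = PρP` (`|c| = exp(−4)`) to `|a| ∈ {1, exp(−2)}`
  have hc0 : P * ρ P ≠ 0 := mul_ne_zero hP0 ((map_ne_zero ρ).2 hP0)
  have hρc : ρ (P * ρ P) = P * ρ P := by rw [map_mul, hρρ, mul_comm]
  have hτc : τ (P * ρ P) = P * ρ P := by rw [map_mul, hτP, hτρP]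
  have hvc : ∀ k : ℤ, Valued.v ((P * ρ P) ^ k) = exp (-(4 * k)) := fun k => by
    rw [map_zpow₀, map_mul, hvρ, hP, ← exp_add, ← exp_zsmul, smul_eq_mul]; congr 1; ring
  obtain ⟨n, hn⟩ := hfixτ a₀ hτa₀ ha₀0
  have key : ∀ a : K, a ≠ 0 → τ a = a → ρ a = w * a → (Valued.v a = 1 ∨ Valued.v a = exp (-2 : ℤ)) →
      ∃ z : K, τ z = z ∧ Valued.v z = 1 ∧ ρ z / z = w ∧ Valued.v (z - 1) ≤ exp (-(e - 2 * dK + 2)) := by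
    intro a ha0 hτa hρa hva
    obtain ⟨a', b', ha', hb', rfl⟩ := exists_coords_tauFixed hτ hρρ hΘρ hτP hρP hτa
    have hmax := v_coords_eq_max hF4 hP ha' hb'
    have hsub : ρ (a' + b' * P) - (a' + b' * P) = -(b' * (P - ρ P)) := by rw [map_add, map_mul, ha'.1, hb'.1]; ring
    -- `|a − ρa| = |a|·|w − 1|`
    have hdepth : Valued.v b' * exp (-(2 * (dK : ℤ))) = Valued.v (a' + b' * P) * Valued.v (w - 1) := by
      rw [← hdK, ← map_mul, ← Valuation.map_neg, ← hsub, hρa, ← map_mul]; congr 1; ring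
    -- parity facts
    have hb'ne : Valued.v b' * exp (-2 : ℤ) ≠ 1 := by
      rcases eq_or_ne b' 0 with rfl | hb0
      · rw [map_zero, zero_mul]; exact zero_ne_one
      obtain ⟨k, hk⟩ := hF4 b' hb'.1 hb'.2 hb0
      rw [hk, ← exp_add, ← exp_zero, Ne, exp_inj]; omega
    have ha'ne : Valued.v a' ≠ exp (-2 : ℤ) := by
      rcases eq_or_ne a' 0 with rfl | ha0'
      · rw [map_zero]; exact (exp_ne_zero).symm
      obtain ⟨k, hk⟩ := hF4 a' ha'.1 ha'.2 ha0'
      rw [hk, Ne, exp_inj]; omega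
    rcases hva with hva | hva
    · -- the unit coset: `|a′| = 1`, `|b′| ≤ exp(−e + 2d_K)`
      have ha'1 : Valued.v a' = 1 := by
        rcases max_choice (Valued.v a') (Valued.v b' * exp (-2 : ℤ)) with h | h
        · rw [← h, ← hmax, hva]
        · exact absurd (by rw [← h, ← hmax, hva]) hb'ne.symm
      have ha'0 : a' ≠ 0 := fun h0 => by rw [h0, map_zero] at ha'1; exact zero_ne_one ha'1
      have hb'le : Valued.v b' * exp (-(2 * (dK : ℤ))) ≤ exp (-e) := by
        rw [hdepth, hva, one_mul]; exact hwe
      refine ⟨(a' + b' * P) / a', ?_, ?_, ?_, ?_⟩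
      · rw [map_div₀, map_add, map_mul, ha'.2, hb'.2, hτP]
      · rw [map_div₀, hva, ha'1, div_one]
      · rw [map_div₀, ha'.1, hρa, div_div_div_cancel_right₀ ha'0, mul_div_assoc, div_self ha0, mul_one]
      · have hz : (a' + b' * P) / a' - 1 = b' / a' * P := by field_simp; ring
        rw [hz, map_mul, map_div₀, ha'1, div_one, hP]
        have h4 : Valued.v b' * exp (-2 : ℤ) = Valued.v b' * exp (-(2 * (dK : ℤ))) * exp (2 * (dK : ℤ) - 2) := by
          rw [mul_assoc, ← exp_add]; congr 2; ring
        rw [h4]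
        calc Valued.v b' * exp (-(2 * (dK : ℤ))) * exp (2 * (dK : ℤ) - 2) ≤ exp (-e) * exp (2 * (dK : ℤ) - 2) := mul_le_mul_left hb'le _
          _ = exp (-(e - 2 * dK + 2)) := by rw [← exp_add]; congr 1; ring
    · -- the `P`-coset is excluded: it would give `|w − 1| = exp(−(2d_K − 2))`
      exfalso
      have hb'1 : Valued.v b' * exp (-2 : ℤ) = exp (-2 : ℤ) := by
        rcases max_choice (Valued.v a') (Valued.v b' * exp (-2 : ℤ)) with h | h
        · exact absurd (by rw [← h, ← hmax, hva]) ha'ne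
        · rw [← h, ← hmax, hva]
      have hb'v : Valued.v b' = 1 := by
        have := hb'1; rwa [mul_eq_right₀ (exp_ne_zero)] at this
      have hw1 : Valued.v (w - 1) = exp (-(2 * (dK : ℤ) - 2)) := by
        have h := hdepth
        rw [hb'v, one_mul, hva] at h
        have h' : Valued.v (w - 1) = exp (-(2 * (dK : ℤ))) / exp (-2 : ℤ) := by
          rw [eq_div_iff exp_ne_zero, mul_comm]; exact h.symm
        rw [h', ← exp_sub]; congr 1; ring
      rw [hw1, exp_le_exp] at hwe
      omega
  obtain ⟨k, hk | hk⟩ := Int.even_or_odd' n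
  · refine key (a₀ * (P * ρ P) ^ k) (mul_ne_zero ha₀0 (zpow_ne_zero _ hc0)) (by rw [map_mul, map_zpow₀, hτa₀, hτc])
      (by rw [map_mul, map_zpow₀, hρc, hwa₀, mul_assoc]) (Or.inl ?_)
    rw [map_mul, hn, hvc, ← exp_add, ← exp_zero]; congr 1; omega
  · refine key (a₀ * (P * ρ P) ^ (k + 1)) (mul_ne_zero ha₀0 (zpow_ne_zero _ hc0)) (by rw [map_mul, map_zpow₀, hτa₀, hτc])
      (by rw [map_mul, map_zpow₀, hρc, hwa₀, mul_assoc]) (Or.inr ?_)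
    rw [map_mul, hn, hvc, ← exp_add]; congr 1; omega

/-! ## §3 The layer `M ∕ K_τ` -/

/-- **NORMS OF ONE-UNITS TO THE FOURTH FIELD**: for the datum `(τ, α, dτ)` on `M`, `|y − 1| ≤ exp(−i)` with `dτ ≤ i + 1` gives `|yτy − 1| ≤ exp(−(i + dτ − 1))`
(`yτy − 1 = Tr_τ(x) + xτx`, `x = y − 1`, ★ trace bound `|Tr_τ x| ≤ |α|^{dτ−1}|x|`). [cite: Serre1979, Ch. III §3 Prop. 7] [cite: Serre1979, Ch. V §3 Prop. 5] -/
theorem v_mul_tau_sub_one_le (hDτ : IsRamifiedQuadraticDatum τ α dτ tτ) {y : K} {i : ℕ} (hy : Valued.v (y - 1) ≤ exp (-(i : ℤ)))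
    (hi : dτ ≤ i + 1) : Valued.v (y * τ y - 1) ≤ exp (-((i : ℤ) + dτ - 1)) := by
  obtain ⟨-, hvτ, hα, -, -, hd1, -⟩ := id hDτ
  have htr := trace_bound_pow_of_isRamifiedQuadraticDatum hDτ (y - 1)
  have hsplit : y * τ y - 1 = ((y - 1) + τ (y - 1)) + (y - 1) * τ (y - 1) := by rw [map_sub, map_one]; ring
  rw [hsplit]
  refine (Valuation.map_add _ _ _).trans (max_le (htr.trans ?_) ?_)
  · rw [hα, ← exp_nsmul, nsmul_eq_mul]
    calc exp (((dτ - 1 : ℕ) : ℤ) * (-1 : ℤ)) * Valued.v (y - 1) ≤ exp (((dτ - 1 : ℕ) : ℤ) * (-1 : ℤ)) * exp (-(i : ℤ)) :=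
          mul_le_mul_right hy _
      _ = exp (-((i : ℤ) + dτ - 1)) := by rw [← exp_add]; congr 1; omega
  · rw [map_mul, hvτ]
    calc Valued.v (y - 1) * Valued.v (y - 1) ≤ exp (-(i : ℤ)) * exp (-(i : ℤ)) := mul_le_mul' hy hy
      _ = exp (-(2 * (i : ℤ))) := by rw [← exp_add]; congr 1; ring
      _ ≤ exp (-((i : ℤ) + dτ - 1)) := by rw [exp_le_exp]; omega

/-! ## §4 The layer `M ∕ E` -/

/-- **TWISTS OF ONE-UNITS**: for the ramified datum `(ρ, α, d_ρ)`, `|y − 1| ≤ exp(−(2c + 1))` gives `|ρy∕y − 1| ≤ exp(−(2c + d_ρ))` (coordinates `y − 1 = a + bα`: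
`|bα| ≤ |y − 1|` so `|b| ≤ exp(−2c)`, and `ρy − y = b(ρα − α)`). [cite: Serre1979, Ch. IV §1 Prop. 3–4] -/
theorem v_twist_sub_one_le_of_oneUnit (hD : IsRamifiedQuadraticDatum ρ α dρ t) {y : K} {c : ℕ}
    (hy : Valued.v (y - 1) ≤ exp (-(2 * (c : ℤ) + 1))) : Valued.v (ρ y / y - 1) ≤ exp (-(2 * (c : ℤ) + dρ)) := by
  obtain ⟨hρρ, hvρ, hα, hfix, hdd, -, -⟩ := id hD
  have hρα : ρ α ≠ α := map_ne_self_of_datum hD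
  have hy1 : Valued.v y = 1 := by
    have hlt : Valued.v (y - 1) < 1 := hy.trans_lt (by rw [← exp_zero, exp_lt_exp]; omega)
    have : y = 1 + (y - 1) := by ring
    rw [this, Valuation.map_add_eq_of_lt_left _ (by rw [Valuation.map_one]; exact hlt), Valuation.map_one]
  have hy0 : y ≠ 0 := fun h0 => by rw [h0, map_zero] at hy1; exact zero_ne_one hy1
  obtain ⟨a, b, ha, hb, hab⟩ := Literature.NumberTheory.LocalFields.exists_fixed_coords_of_map_ne hρρ hρα (y - 1)
  have hmax := Literature.NumberTheory.LocalFields.v_fixed_add_fixed_mul_eq_max (even_log_v_of_fixed hfix) hα ha hb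
  have hbα : Valued.v b * exp (-1 : ℤ) ≤ Valued.v (y - 1) := by rw [hab, hmax]; exact le_max_right _ _
  have hb1 : Valued.v b ≤ exp (-(2 * (c : ℤ))) := by
    have h := hbα.trans hy
    rw [show (-(2 * (c : ℤ) + 1)) = -(2 * (c : ℤ)) + (-1 : ℤ) by ring, exp_add] at h
    exact le_of_mul_le_mul_right h (by exact zero_lt_iff.2 exp_ne_zero)
  have hsub : ρ y - y = b * (ρ α - α) := by
    have : y = 1 + (a + b * α) := by rw [← hab]; ring
    rw [this, map_add, map_one, map_add, map_mul, ha, hb]; ring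
  rw [div_sub_one hy0, map_div₀, hy1, div_one, hsub, map_mul, ← neg_sub α, Valuation.map_neg, v_sub_map_eq_exp_of_datum hD]
  calc Valued.v b * exp (-(dρ : ℤ)) ≤ exp (-(2 * (c : ℤ))) * exp (-(dρ : ℤ)) := mul_le_mul_left hb1 _
    _ = exp (-(2 * (c : ℤ) + dρ)) := by rw [← exp_add]; congr 1; ring

/-- **NORM-ONE ELEMENTS OF DEPTH `≥ 2c + d_ρ` ARE TWISTS OF ONE-UNITS OF DEPTH `≥ 2c + 1`**: `tρt = 1`, `|t − 1| ≤ exp(−(2c + d_ρ))` ⇒ `t = ρy∕y` with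
`|y − 1| ≤ exp(−(2c + 1))` (★ Hilbert 90 representatives `t = a∕ρa`, `|a| ∈ {1, |α|}`; the `α`-coset has depth EXACTLY `d_ρ − 1` ★ and is excluded; on the unit coset
★ `exists_fixed_mul_of_unit_depth` factors `a = f·w`, `|w − 1| ≤ |α|^{2c+1}`, and `y = ρw`). [cite: Serre1979, Ch. X §1] [cite: Serre1979, Ch. V §3] -/
theorem exists_oneUnit_twist_eq (hD : IsRamifiedQuadraticDatum ρ α dρ t) {t' : K} (ht' : t' * ρ t' = 1) {c : ℕ}
    (hdepth : Valued.v (t' - 1) ≤ exp (-(2 * (c : ℤ) + dρ))) :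
    ∃ y : K, Valued.v (y - 1) ≤ exp (-(2 * (c : ℤ) + 1)) ∧ ρ y / y = t' := by
  obtain ⟨hρρ, hvρ, hα, hfix, hdd, hd1, -⟩ := id hD
  obtain ⟨a, hta, hva⟩ := exists_rep_of_mul_map_eq_one hρρ hvρ hα hdd ht'
  have ha0 : a ≠ 0 := by
    rcases hva with h | h
    · exact fun h0 => by rw [h0, map_zero] at h; exact zero_ne_one h
    · exact fun h0 => by rw [h0, map_zero, hα] at h; exact exp_ne_zero h.symm
  have hρa0 : ρ a ≠ 0 := (map_ne_zero ρ).2 ha0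
  rcases hva with hva | hva
  · -- unit coset
    have hdep : Valued.v (a - ρ a) ≤ Valued.v α ^ (dρ + 2 * c) := by
      have h1 : a - ρ a = (a / ρ a - 1) * ρ a := by field_simp
      rw [h1, map_mul, hvρ, hva, mul_one, ← hta, hα, ← exp_nsmul, nsmul_eq_mul]
      refine hdepth.trans_eq ?_; congr 1; push_cast; ring
    obtain ⟨f, w, hρf, hf1, hw, rfl⟩ := exists_fixed_mul_of_unit_depth hρρ hfix hα hdd hva hdep
    have hf0 : f ≠ 0 := fun h0 => by rw [h0, map_zero] at hf1; exact zero_ne_one hf1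
    have hw0 : w ≠ 0 := fun h0 => ha0 (by rw [h0, mul_zero])
    refine ⟨ρ w, ?_, ?_⟩
    · have h1 : ρ w - 1 = ρ (w - 1) := by rw [map_sub, map_one]
      rw [h1, hvρ]
      refine hw.trans_eq ?_
      rw [hα, ← exp_nsmul, nsmul_eq_mul]; congr 1; push_cast; ring
    · rw [hρρ, hta, map_mul, hρf, mul_div_mul_left _ _ hf0]
  · -- the `α`-coset: depth exactly `d_ρ − 1`, contradiction
    exfalso
    have hexact := v_div_map_sub_one_eq_of_v_eq_v_varpi hρρ hvρ hfix hα hdd hd1 hva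
    rw [← hta, hα, ← exp_nsmul, nsmul_eq_mul] at hexact
    rw [hexact, exp_le_exp] at hdepth
    omega

end Summit.HodgeConjecture.HodgeConjecture.Cruxes.H413.F0P3cDyRamToricLevelCensusRamM

end
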